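import Literature.MathematicalPhysics.QuantumLattice.HubbardPairDensityCouplingFloor
import Literature.MathematicalPhysics.QuantumLattice.FreeFermionSectorEnergyDeviation
import Literature.MathematicalPhysics.QuantumLattice.FinDimSpectrumSectorGibbsLimit
import Literature.MathematicalPhysics.QuantumLattice.HubbardAtomicLimit
import Literature.MathematicalPhysics.QuantumLattice.TorusCooperSum
import HarnessLib

/-!
# Ground states of the repulsive Hubbard torus have few doublons: `U ⟨N_d⟩ ≤ 4 N`

Proof-only file. For the pure Hubbard model `H = H₀ + U Σ_x n_{x↑} n_{x↓}` on the torus `(ℤ/Lℤ)²`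
(`hubbardTorus 2 L 1 U`, `L ≥ 3`) and a ground state `ψ` of the sector `(N, S^z) = (2n, 0)` with
`2n ≤ L²`:

* `re_expect_hubbardTorus_zero_ge` — the kinetic energy of ANY vector of the `(n, n)` sector is at
  least `-4 N ‖ψ‖²` (`H₀ = Σ_{kσ} ε(k) n_{kσ}`, `ε(k) ≥ -4`, `Σ_{kσ} ⟨n_{kσ}⟩ = N ‖ψ‖²`);
* `star_single_pairSet_hubbardTorus_eq_zero`, `minEnergyOn_szSector_hubbardTorus_le_zero` — a
  configuration with `n` up electrons on `A` and `n` down electrons on a disjoint `B` has energy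
  exactly `0` (the hopping term has no diagonal matrix elements, the interaction counts the empty
  set `A ∩ B`), so the sector ground-state energy is `≤ 0` for every `U`;
* `hubbardTorus_groundState_doublon_le` — **hence `U · Re ⟨ψ, Σ_x n_{x↑}n_{x↓} ψ⟩ ≤ 4 N ‖ψ‖²`**:
  the doublon density of a repulsive ground state is at most `4(1-δ)/U` (`U > 0`), uniformly in `L`.

Together with `PairFieldCarrierBound` (pair-field density `≤ 80(δ + 2 n_d) + 240/L²`) this bounds the
`d`-wave order parameter of Hubbard ground states near the Mott corner: `≤ 80 δ + 640/U + o(1)`.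
Folklore (e.g. the starting point of every large-`U` / `t`-`J` reduction: Tasaki, J. Phys. Cond. Matt.
10 (1998) 4353, §5.1); no definition, no named fact.
-/

namespace Literature.MathematicalPhysics.QuantumLattice

open Matrix Finset
open Literature.Probability.LatticeModels
open scoped ComplexOrder

variable (L : ℕ) [NeZero L]

/-! ### Kinetic energy is bounded below by `-4 N` -/

/-- **`Re ⟨ψ, H₀ ψ⟩ ≥ -4 (a + b) ‖ψ‖²` on the `(a, b)` sector** of the torus of side `L ≥ 3`:
`H₀ = Σ_{kσ} ε(k) n_{kσ}` with `ε(k) ≥ -4` and `Σ_k ⟨n_{k↑}⟩ = a ‖ψ‖²`, `Σ_k ⟨n_{k↓}⟩ = b ‖ψ‖²`.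
BGM 2006 §1.2 (the free band). [folklore] -/
theorem re_expect_hubbardTorus_zero_ge (hL : 3 ≤ L) {a b : ℕ} {ψ : Fock (Orb (FermionTorus 2 L))}
    (hψ : IsInSector a b ψ) :
    -4 * ((a : ℝ) + b) * (star ψ ⬝ᵥ ψ).re ≤ (star ψ ⬝ᵥ (hubbardTorus 2 L 1 0 *ᵥ ψ)).re := by
  rw [hubbardTorus_zero_eq_sum_momentumNumber hL, Matrix.sum_mulVec, dotProduct_sum, Complex.re_sum]
  have hk : ∀ k : TorusSite 2 L,
      -4 * ((star ψ ⬝ᵥ (momentumNumber k 0 *ᵥ ψ)).re + (star ψ ⬝ᵥ (momentumNumber k 1 *ᵥ ψ)).re) ≤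
        (star ψ ⬝ᵥ ((∑ σ : Fin 2, ((torusBand L k : ℝ) : ℂ) • momentumNumber k σ) *ᵥ ψ)).re := by
    intro k
    rw [Matrix.sum_mulVec, dotProduct_sum, Complex.re_sum, Fin.sum_univ_two]
    simp only [Fin.isValue, Matrix.smul_mulVec, dotProduct_smul, smul_eq_mul, Complex.re_ofReal_mul]
    have h0 := (re_expect_momentumNumber_mem_Icc k 0 ψ).1
    have h1 := (re_expect_momentumNumber_mem_Icc k 1 ψ).1
    have hε := neg_four_le_torusBand L k
    nlinarith
  calc -4 * ((a : ℝ) + b) * (star ψ ⬝ᵥ ψ).re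
      = -4 * (∑ k : TorusSite 2 L, (star ψ ⬝ᵥ (momentumNumber k 0 *ᵥ ψ)).re +
          ∑ k : TorusSite 2 L, (star ψ ⬝ᵥ (momentumNumber k 1 *ᵥ ψ)).re) := by
        rw [sum_re_expect_momentumNumber_up hψ, sum_re_expect_momentumNumber_down hψ]
        ring
    _ = ∑ k : TorusSite 2 L, -4 * ((star ψ ⬝ᵥ (momentumNumber k 0 *ᵥ ψ)).re +
          (star ψ ⬝ᵥ (momentumNumber k 1 *ᵥ ψ)).re) := by
        rw [← Finset.sum_add_distrib, Finset.mul_sum]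
    _ ≤ _ := Finset.sum_le_sum fun k _ => hk k

/-! ### A doublon-free configuration has energy zero -/

/-- The hopping term has no diagonal matrix elements: `(c†_a c_b)_{ss} = 0` for `a ≠ b`.
Bratteli–Robinson II §5.2.2. [folklore] -/
theorem creation_mul_annihilation_apply_self_eq_zero {ι : Type*} [LinearOrder ι] [Fintype ι] {a b : ι}
    (hab : a ≠ b) (s : Finset ι) : (creation a * annihilation b) s s = 0 := by
  rw [LiebThm1.creation_mul_annihilation_apply]
  split_ifs with h
  · exfalso
    obtain ⟨ha, -, hs⟩ := h
    have : a ∈ insert b (s.erase a) := hs ▸ ha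
    rw [Finset.mem_insert] at this
    rcases this with h' | h'
    · exact hab h'
    · exact (Finset.notMem_erase a s) h'
  · rfl

omit [NeZero L] in
/-- **The energy of the occupation-basis vector `|A↑ ∪ B↓⟩` with `A ∩ B = ∅` is zero**: the hopping
part of `hubbardTorus 2 L 1 U` has vanishing diagonal entries and the interaction counts the doubly
occupied sites `A ∩ B = ∅`. Tasaki (1998) §5.1 (the atomic-limit ground states). [folklore] -/
theorem star_single_pairSet_hubbardTorus_eq_zero (U : ℝ) {A B : Finset (FermionTorus 2 L)}
    (hAB : Disjoint A B) :
    (star (Pi.single (pairSet A B) (1 : ℂ)) ⬝ᵥ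
      (hubbardTorus 2 L 1 U *ᵥ Pi.single (pairSet A B) 1)).re = 0 := by
  -- `(_)`: the `DecidableEq` instance of `Matrix.diagonal_apply_eq` is taken by unification (the
  -- Hubbard orbital type carries two propositionally equal `DecidableEq` instances).
  rw [Literature.Computability.AlgebraicComplexity.star_single_dotProduct_mulVec_single,
    hubbardTorus_eq_zero_add_smul_interaction U, Matrix.add_apply, Matrix.smul_apply,
    sum_numberOp_mul_numberOp_eq_diagonal, @Matrix.diagonal_apply_eq _ _ (_)]
  -- the interaction: no doubly occupied site
  have hd : (doublyOccupied (pairSet A B)).card = 0 := by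
    rw [Finset.card_eq_zero, Finset.eq_empty_iff_forall_notMem]
    intro x hx
    rw [mem_doublyOccupied, orb_zero_mem_pairSet, orb_one_mem_pairSet] at hx
    exact Finset.disjoint_left.1 hAB hx.1 hx.2
  -- the hopping: zero diagonal
  have hh : (hubbardTorus 2 L 1 0) (pairSet A B) (pairSet A B) = 0 := by
    unfold hubbardTorus hamiltonian
    simp only [Matrix.add_apply, Matrix.smul_apply, Matrix.sum_apply, Complex.ofReal_zero, zero_smul]
    rw [Finset.sum_eq_zero fun x _ => Finset.sum_eq_zero fun y _ => Finset.sum_eq_zero fun σ _ => ?_]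
    · simp
    · split_ifs with hxy
      · exact creation_mul_annihilation_apply_self_eq_zero
          (fun h => (fermionTorusGraph 2 L).ne_of_adj hxy (orb_inj.1 h).1) _
      · rfl
  rw [hh, hd]
  simp

omit [NeZero L] in
/-- **The sector ground-state energy of the repulsive (or attractive) Hubbard torus is `≤ 0`** in every
sector `(2n, S^z = 0)` with `2n ≤ L²`: choose `n` sites `A` and `n` further sites `B` and use the
doublon-free trial vector `|A↑ ∪ B↓⟩` (energy `0`, `star_single_pairSet_hubbardTorus_eq_zero`) in the
variational principle. Tasaki (1998) §5.1. [folklore] -/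
theorem minEnergyOn_szSector_hubbardTorus_le_zero (U : ℝ) {n : ℕ} (hn : 2 * n ≤ L ^ 2) :
    (hubbardTorus 2 L 1 U).minEnergyOn (szSector (Λ := FermionTorus 2 L) (2 * n) 0) ≤ 0 := by
  classical
  -- `2n` sites, split into two halves
  have hcard : 2 * n ≤ (Finset.univ : Finset (FermionTorus 2 L)).card := by
    rw [Finset.card_univ]
    simpa [FermionTorus, Fintype.card_fin] using hn
  obtain ⟨C, -, hC⟩ := Finset.exists_subset_card_eq hcard
  have hnC : n ≤ C.card := by omega
  obtain ⟨A, hAC, hA⟩ := Finset.exists_subset_card_eq hnC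
  set B := C \ A with hB
  have hBcard : B.card = n := by
    rw [hB, Finset.card_sdiff, Finset.inter_eq_left.2 hAC, hC, hA]
    omega
  have hAB : Disjoint A B := by
    rw [hB]
    exact Finset.disjoint_sdiff
  -- the trial vector
  have hmem : (Pi.single (pairSet A B) (1 : ℂ) : Fock (Orb (FermionTorus 2 L))) ∈
      szSector (Λ := FermionTorus 2 L) (2 * n) 0 := by
    rw [mem_szSector_two_mul_zero_iff]
    intro s hs
    by_cases hs0 : s = pairSet A B
    · subst hs0
      exact absurd ⟨by rw [upPart_pairSet, hA], by rw [downPart_pairSet, hBcard]⟩ hs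
    · simp [hs0]
  have h1 : star (Pi.single (pairSet A B) (1 : ℂ) : Fock (Orb (FermionTorus 2 L))) ⬝ᵥ
      Pi.single (pairSet A B) 1 = 1 :=
    Literature.Computability.AlgebraicComplexity.star_single_dotProduct_single _
  have hH : (hubbardTorus 2 L 1 U).IsHermitian := LiebThm1.hamiltonian_isHermitian _ 1 U
  have hle := minEnergyOn_le_rayleigh_of_mem hH _ hmem h1
  rw [star_single_pairSet_hubbardTorus_eq_zero L U hAB] at hle
  exact hle

/-! ### The doublon bound -/

/-- **Ground states of the repulsive Hubbard torus have few doublons.** For `L ≥ 3`, any real `U`,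
`2n ≤ L²` and every ground state `ψ` of `hubbardTorus 2 L 1 U` in the sector `(2n, S^z = 0)`:
`U · Re ⟨ψ, Σ_x n_{x↑} n_{x↓} ψ⟩ ≤ 4 · (2n) · ‖ψ‖²`, i.e. for `U > 0` the doublon density is at most
`4(1-δ)/U` at filling `1 - δ`. Proof: `E₀ ‖ψ‖² = ⟨H₀⟩ + U ⟨N_d⟩` with `E₀ ≤ 0`
(`minEnergyOn_szSector_hubbardTorus_le_zero`) and `⟨H₀⟩ ≥ -4 N ‖ψ‖²`
(`re_expect_hubbardTorus_zero_ge`). Tasaki (1998) §5.1. [folklore] -/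
theorem hubbardTorus_groundState_doublon_le (hL : 3 ≤ L) (U : ℝ) {n : ℕ}
    (hn : 2 * n ≤ L ^ 2) {ψ : Fock (Orb (FermionTorus 2 L))}
    (hψ : IsGroundStateInSector (hubbardTorus 2 L 1 U) (2 * n) 0 ψ) :
    U * (star ψ ⬝ᵥ ((∑ x : FermionTorus 2 L, numberOp x 0 * numberOp x 1 :
        Matrix (Finset (Orb (FermionTorus 2 L))) (Finset (Orb (FermionTorus 2 L))) ℂ) *ᵥ ψ)).re ≤
      4 * (2 * n : ℕ) * (star ψ ⬝ᵥ ψ).re := by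
  obtain ⟨hmem, -, hHψ⟩ := hψ
  have hsec : IsInSector n n ψ := (mem_szSector_two_mul_zero_iff n ψ).1 hmem
  -- `⟨ψ, H ψ⟩ = E₀ ‖ψ‖² ≤ 0`
  have hE : (star ψ ⬝ᵥ (hubbardTorus 2 L 1 U *ᵥ ψ)).re =
      (hubbardTorus 2 L 1 U).minEnergyOn (szSector (Λ := FermionTorus 2 L) (2 * n) 0) *
        (star ψ ⬝ᵥ ψ).re := by
    rw [hHψ, dotProduct_smul, smul_eq_mul, Complex.re_ofReal_mul]
  have hE0 := minEnergyOn_szSector_hubbardTorus_le_zero L U hn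
  have hnorm : 0 ≤ (star ψ ⬝ᵥ ψ).re := (Complex.nonneg_iff.1 (dotProduct_star_self_nonneg ψ)).1
  have hle0 : (star ψ ⬝ᵥ (hubbardTorus 2 L 1 U *ᵥ ψ)).re ≤ 0 := by
    rw [hE]
    exact mul_nonpos_of_nonpos_of_nonneg hE0 hnorm
  -- split `H = H₀ + U N_d`
  have hsplit : (star ψ ⬝ᵥ (hubbardTorus 2 L 1 U *ᵥ ψ)).re =
      (star ψ ⬝ᵥ (hubbardTorus 2 L 1 0 *ᵥ ψ)).re +
        U * (star ψ ⬝ᵥ ((∑ x : FermionTorus 2 L, numberOp x 0 * numberOp x 1 :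
          Matrix (Finset (Orb (FermionTorus 2 L))) _ ℂ) *ᵥ ψ)).re := by
    rw [hubbardTorus_eq_zero_add_smul_interaction U, add_mulVec, Matrix.smul_mulVec, dotProduct_add,
      dotProduct_smul, smul_eq_mul, Complex.add_re, Complex.re_ofReal_mul]
  have hkin := re_expect_hubbardTorus_zero_ge L hL hsec
  push_cast at hkin ⊢
  linarith

end Literature.MathematicalPhysics.QuantumLattice
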